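import Summits.HodgeConjecture.HodgeConjecture.Theorems.HolomorphicityRateRateGapOfHodge
import Literature.AlgebraicGeometry.HodgeTheory.HardLefschetzNFoldHolds
import Literature.AlgebraicGeometry.HodgeTheory.PencilStepBelowMiddleHolds
import Literature.AlgebraicGeometry.HodgeTheory.HypersurfaceLefschetz
import Literature.AlgebraicGeometry.HodgeTheory.HodgeTypeConjugation
import HarnessLib

/-!
# Route `HolomorphicityRate`, crux `RateGap` (R1): the residual content of the crux is the Hodge
# conjecture for PRIMITIVE middle-dimensional classes — the second reshape of line `registered` (c3)

Crux item `stmt-HodgeConjecture-10762` (`HolomorphicityRate.RateGap`). The registered line closes the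
crux by cancellation on the ray modulo the Hodge conjecture (leads c1/c2: codimensions
`2 ≤ p ≤ n/2`; lead c3, first reshape: the middle dimension `2p = n`, BFNP 2009 Lemma 48). This file
carries the reduction one classical step further, entirely inside the tree: **the Hodge conjecture is
equivalent to the algebraicity of the rational `(m,m)`-classes `c` on smooth projective `2m`-folds,
`m ≥ 2`, which are PRIMITIVE, `[H] ∪ c = 0`** (for every hard Lefschetz datum
`Λ : HardLefschetzNFold (2m) X`, `[H] = Λ.hyperplaneClass`). Ingredients, all theorems of the tree:

* the first step of the Lefschetz decomposition in the middle degree with rationality and Hodge types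
  (`exists_primitive_add_lefschetzOperator`: `c = c₀ + [H] ∪ c'`, `c₀` primitive rational `(m,m)`,
  `c'` rational `(m-1,m-1)`; from the fields of `HardLefschetzNFold` — hard Lefschetz bijectivity of
  `L² : H^{2m-2} → H^{2m+2}`, rationality and type descent along it — and `IsOfHodgeType.sub`);
* the Lefschetz-pencil step below the middle (`mem_algebraicClasses_of_two_mul_le`,
  de Cataldo–Migliorini 2009 / Thomas 2005, discharged in `PencilStepBelowMiddleHolds`);
* hard Lefschetz above the middle (`HardLefschetzNFold.mem_algebraicClasses_of_lt_holds`);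
* Lefschetz `(1,1)` (`lefschetzOneOne_rational_holds`), the top degree
  (`mem_algebraicClasses_of_degree_top`), codimension `0` (`algebraicClasses_zero`), degrees above
  `2 dim` (`algebraicClasses_eq_top_of_lt`), `[H] ∪ Nˡ ⊆ N^{l+1}`
  (`HardLefschetzNFold.lefschetzOperator_mem_algebraicClasses`), Hodge models
  (`nonempty_hodgeModel_holds`) and hard Lefschetz data (`nonempty_hardLefschetzNFold_holds`).

Results (helpers towards the crux, `--supports`):

* `mem_algebraicClasses_of_hodgePrimitiveMiddle` — from the primitive middle stub, the Hodge
  conjecture in every dimension and codimension (strong induction on the dimension, inner strong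
  induction on the codimension);
* `hodgeConjecture_of_hodgePrimitiveMiddle`, `hodgePrimitiveMiddle_of_hodgeConjecture`,
  `hodgeConjecture_iff_hodgePrimitiveMiddle` — **the primitive middle stub is equivalent to the summit
  statement `_root_.HodgeConjecture`**;
* `hodgeMiddle_of_hodgePrimitiveMiddle` — it implies the middle stub of the first reshape;
* `rateGap_of_hodgePrimitiveMiddle` — the crux from the primitive middle stub (registered sub-goal).

## References

* C. Voisin, *Hodge Theory and Complex Algebraic Geometry I* (2002), §6.2.3, Thm. 6.25, Rem. 6.27,
  Thm. 11.30.
* M. A. de Cataldo, L. Migliorini, *The decomposition theorem, perverse sheaves and the topology of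
  algebraic maps*, Bull. AMS 46 (2009), §4, proof of Prop. 4.5 (arXiv:0711.1307).
* R. Thomas, *Nodes and the Hodge conjecture*, J. Algebraic Geom. 14 (2005), Prop. 2.
* M. Kerr, G. Pearlstein, *An exponential history of functions with logarithmic growth* (2011), §3.1.
* P. Deligne, *The Hodge conjecture*, Clay problem description (2000), §1.
-/

noncomputable section

open scoped Manifold ContDiff Topology
open Set Filter

set_option linter.dupNamespace false

namespace Summit.HodgeConjecture.HodgeConjecture.Theorems

open Literature.AlgebraicGeometry.HodgeTheory Literature.AlgebraicGeometry.Motives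
  Literature.AlgebraicTopology.SingularHomology Literature.Geometry.Kaehler

/-- **First step of the Lefschetz decomposition in the middle degree, with rationality and Hodge
types.** On a smooth projective `X` of dimension `n = 2l + 2` with hard Lefschetz datum `Λ`
(`[H] = Λ.hyperplaneClass`, `L = [H] ∪ ·`), every rational class `c ∈ H^{2(l+1)}(X(ℂ); ℂ)` of type
`(l+1, l+1)` splits as `c = c₀ + L c'` with `c₀ ∈ H^{2(l+1)}` PRIMITIVE (`L c₀ = 0`), rational, of type
`(l+1, l+1)`, and `c' ∈ H^{2l}` rational of type `(l, l)`: take `c'` with `L² c' = L c` (hard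
Lefschetz: `L² : H^{2l} → H^{2l+4}` is bijective since `2l + 2 = n`; `c'` is rational and of type
`(l, l)` because `L c` is rational of type `(l+2, l+2)` — `isRationalClass_L_iff`,
`isOfHodgeType_L_iff`) and `c₀ := c - L c'`. [cite: VoisinHodgeI2002, §6.2.3, Thm. 6.25 and Rem. 6.27] -/
theorem exists_primitive_add_lefschetzOperator {l : ℕ} {X : Literature.AlgebraicGeometry.Motives.SchemeOver ℂ}
    (hX : IsSmoothProjective (2 * (l + 1)) X) (Λ : HardLefschetzNFold (2 * (l + 1)) X)
    (c : complexBetti X (2 * (l + 1))) (hc : IsRationalClass c)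
    (hpp : IsOfHodgeType (2 * (l + 1)) X (2 * (l + 1)) (l + 1) (l + 1) c) :
    ∃ (c₀ : complexBetti X (2 * (l + 1))) (c' : complexBetti X (2 * l)),
      IsRationalClass c₀ ∧ IsOfHodgeType (2 * (l + 1)) X (2 * (l + 1)) (l + 1) (l + 1) c₀ ∧
        lefschetzOperator Λ.hyperplaneClass (two_add_two_mul (l + 1)) c₀ = 0 ∧
          IsRationalClass c' ∧ IsOfHodgeType (2 * (l + 1)) X (2 * l) l l c' ∧
            c = c₀ + lefschetzOperator Λ.hyperplaneClass (two_add_two_mul l) c' := by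
  -- `d := L c`, rational of type `(l+2, l+2)`
  set d : complexBetti X (2 * (l + 2)) := lefschetzOperator Λ.hyperplaneClass (two_add_two_mul (l + 1)) c
    with hd
  have hd_rat : IsRationalClass d := Λ.isRationalClass_hyperplaneClass.cup _ hc
  have hd_typ : IsOfHodgeType (2 * (l + 1)) X (2 * (l + 2)) (l + 2) (l + 2) d :=
    Λ.isOfHodgeType_lefschetzOperator _ _ (two_add_two_mul (l + 1)) (l + 1) (l + 1) c hpp
  -- `L² : H^{2l} → H^{2l+4}` is bijective (`2l + 2 = n`): `c'` with `L² c' = d`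
  have hjk : 2 * l + 2 = 2 * (l + 1) := by omega
  have hm : 2 * l + 2 * 2 = 2 * (l + 2) := by omega
  obtain ⟨c', hc'⟩ := (Λ.bijective_L hjk (2 * (l + 2)) hm).2 d
  have hc'_rat : IsRationalClass c' := (Λ.isRationalClass_L_iff hjk (2 * (l + 2)) hm c').1 (hc' ▸ hd_rat)
  have hc'_typ : IsOfHodgeType (2 * (l + 1)) X (2 * l) l l c' :=
    (Λ.isOfHodgeType_L_iff hjk (2 * (l + 2)) hm l l c').1 (hc' ▸ hd_typ)
  -- `L² c' = L (L c')` in the explicit-degree spelling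
  have hLL : Λ.L 2 (2 * l) (2 * (l + 2)) hm c' =
      lefschetzOperator Λ.hyperplaneClass (two_add_two_mul (l + 1))
        (lefschetzOperator Λ.hyperplaneClass (two_add_two_mul l) c') := by
    rw [HardLefschetzNFold.L, lefschetzPowTo_succ_apply Λ.hyperplaneClass 1 (2 * l) (2 * (l + 1)) (2 * (l + 2))
      (by omega) hm (by omega), lefschetzPowTo_succ_apply Λ.hyperplaneClass 0 (2 * l) (2 * l) (2 * (l + 1))
      (by omega) (by omega) (by omega), lefschetzPowTo_zero_apply]
  -- the `L`-image of `c'` is rational of type `(l+1, l+1)`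
  have hLc'_rat : IsRationalClass (lefschetzOperator Λ.hyperplaneClass (two_add_two_mul l) c') :=
    Λ.isRationalClass_hyperplaneClass.cup _ hc'_rat
  have hLc'_typ : IsOfHodgeType (2 * (l + 1)) X (2 * (l + 1)) (l + 1) (l + 1)
      (lefschetzOperator Λ.hyperplaneClass (two_add_two_mul l) c') :=
    Λ.isOfHodgeType_lefschetzOperator _ _ (two_add_two_mul l) l l c' hc'_typ
  refine ⟨c - lefschetzOperator Λ.hyperplaneClass (two_add_two_mul l) c', c', ?_, hpp.sub hX hLc'_typ, ?_,
    hc'_rat, hc'_typ, (sub_add_cancel _ _).symm⟩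
  · -- rationality of `c₀ = c - L c'`
    have hneg : IsRationalClass (-(lefschetzOperator Λ.hyperplaneClass (two_add_two_mul l) c')) := by
      simpa using hLc'_rat.smul (-1)
    simpa [sub_eq_add_neg] using hc.add hneg
  · -- primitivity: `L c₀ = L c - L (L c') = d - L² c' = 0`
    rw [map_sub, ← hLL, hc', hd, sub_self]

/-- **The Hodge conjecture in every dimension and codimension from its primitive middle-dimensional
case.** Granted (`hP`) that on every smooth projective `2m`-fold, `2 ≤ m`, every rational
`(m,m)`-class which is primitive for a hard Lefschetz datum `Λ` (`[H] ∪ c = 0`) is algebraic, every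
rational `(q,q)`-class on every smooth projective `d`-fold is algebraic. Strong induction on `d`, inner
strong induction on `q`: `q = 0` (`algebraicClasses_zero`); `d < q` (`algebraicClasses_eq_top_of_lt`);
`q = 1` (Lefschetz `(1,1)`, `lefschetzOneOne_rational_holds`); `q = d` (top degree,
`mem_algebraicClasses_of_degree_top`); `2q < d` (the Lefschetz-pencil step
`mem_algebraicClasses_of_two_mul_le` from dimension `d - 1`); `d < 2q` (hard Lefschetz down to
codimension `d - q < q`, `HardLefschetzNFold.mem_algebraicClasses_of_lt_holds`); `2q = d`, `q = l + 1 ≥ 2`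
(decompose `c = c₀ + [H] ∪ c'` by `exists_primitive_add_lefschetzOperator` for a hard Lefschetz datum
from `nonempty_hardLefschetzNFold_holds`; `c₀` is algebraic by `hP`, `c'` by the inner induction in
codimension `l`, `[H] ∪ c'` by `HardLefschetzNFold.lefschetzOperator_mem_algebraicClasses`).
[cite: KerrPearlstein2011, §3.1] [cite: Thomas2005Nodes, Prop. 2] [cite: VoisinHodgeI2002, Thm. 6.25 and Rem. 6.27] -/
theorem mem_algebraicClasses_of_hodgePrimitiveMiddle
    (hP : ∀ (m : ℕ) (X : Literature.AlgebraicGeometry.Motives.SchemeOver ℂ), Literature.AlgebraicGeometry.Motives.IsSmoothProjective (2 * m) X → 2 ≤ m → ∀ (Λ : Literature.AlgebraicGeometry.HodgeTheory.HardLefschetzNFold (2 * m) X) (A : Literature.AlgebraicGeometry.HodgeTheory.HodgeModel (2 * m) X) (c : Literature.AlgebraicGeometry.HodgeTheory.complexBetti X (2 * m)), Literature.AlgebraicGeometry.HodgeTheory.IsRationalClass c → A.pullback (2 * m) c ∈ A.hodgePQ (2 * m) m m → Literature.Geometry.Kaehler.lefschetzOperator Λ.hyperplaneClass (Literature.AlgebraicGeometry.HodgeTheory.two_add_two_mul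 m) c = 0 → c ∈ Literature.AlgebraicGeometry.HodgeTheory.algebraicClasses X m) :
    ∀ (d : ℕ) ⦃Y : Literature.AlgebraicGeometry.Motives.SchemeOver ℂ⦄, Literature.AlgebraicGeometry.Motives.IsSmoothProjective d Y →
      ∀ (q : ℕ) (c : Literature.AlgebraicGeometry.HodgeTheory.complexBetti Y (2 * q)), Literature.AlgebraicGeometry.HodgeTheory.IsRationalClass c →
        Literature.AlgebraicGeometry.HodgeTheory.IsOfHodgeType d Y (2 * q) q q c →
          c ∈ Literature.AlgebraicGeometry.HodgeTheory.algebraicClasses Y q := by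
  intro d
  induction d using Nat.strong_induction_on with
  | _ d ihd =>
  intro Y hY q
  induction q using Nat.strong_induction_on with
  | _ q ihq =>
  intro c hc hpp
  rcases Nat.eq_zero_or_pos q with hq0 | hq0
  · subst hq0
    rw [algebraicClasses_zero]
    exact Submodule.mem_top
  rcases lt_or_ge d q with hdq | hqd
  · rw [algebraicClasses_eq_top_of_lt hY hdq]
    exact Submodule.mem_top
  by_cases hq1 : q = 1
  · subst hq1
    exact lefschetzOneOne_rational_holds hY c hc hpp
  by_cases hqd' : q = d
  · subst hqd'
    exact mem_algebraicClasses_of_degree_top hY hq0 c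
  -- now `2 ≤ q < d`
  rcases Nat.lt_trichotomy (2 * q) d with hlt | heq | hgt
  · -- below the middle: the pencil step from dimension `d - 1`
    obtain ⟨d', rfl⟩ : ∃ d', d = d' + 1 := ⟨d - 1, by omega⟩
    exact mem_algebraicClasses_of_two_mul_le hY
      (fun Y' hY' q' c' hc' hpp' => ihd d' (Nat.lt_succ_self d') hY' q' c' hc' hpp') q c (by omega) hc hpp
  · -- the middle: `d = 2q`, `q = l + 1 ≥ 2`
    subst heq
    obtain ⟨l, rfl⟩ : ∃ l, q = l + 1 := ⟨q - 1, by omega⟩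
    obtain ⟨Λ⟩ := nonempty_hardLefschetzNFold_holds (2 * (l + 1)) Y hY
    obtain ⟨c₀, c', hc₀, hc₀t, hprim, hc', hc't, rfl⟩ := exists_primitive_add_lefschetzOperator hY Λ c hc hpp
    obtain ⟨A, hA⟩ := hc₀t
    refine Submodule.add_mem _ (hP (l + 1) Y hY (by omega) Λ A c₀ hc₀ hA hprim) ?_
    exact Λ.lefschetzOperator_mem_algebraicClasses l c' (ihq l (Nat.lt_succ_self l) c' hc' hc't)
  · -- above the middle: hard Lefschetz down to codimension `d - q < q`
    exact HardLefschetzNFold.mem_algebraicClasses_of_lt_holds hY hgt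
      (fun c' hc' hpp' => ihq (d - q) (by omega) c' hc' hpp') c hc hpp


/-- **The primitive middle stub implies the Hodge conjecture** (`_root_.HodgeConjecture`, every smooth
projective `X/ℂ`, every codimension): the cycle conjunct by
`mem_algebraicClasses_of_hodgePrimitiveMiddle`, the Hodge-model conjunct by
`nonempty_hodgeModel_holds`. [cite: KerrPearlstein2011, §3.1] [cite: Deligne2000, §1] -/
theorem hodgeConjecture_of_hodgePrimitiveMiddle
    (hP : ∀ (m : ℕ) (X : Literature.AlgebraicGeometry.Motives.SchemeOver ℂ), Literature.AlgebraicGeometry.Motives.IsSmoothProjective (2 * m) X → 2 ≤ m → ∀ (Λ : Literature.AlgebraicGeometry.HodgeTheory.HardLefschetzNFold (2 * m) X) (A : Literature.AlgebraicGeometry.HodgeTheory.HodgeModel (2 * m) X) (c : Literature.AlgebraicGeometry.HodgeTheory.complexBetti X (2 * m)), Literature.AlgebraicGeometry.HodgeTheory.IsRationalClass c → A.pullback (2 * m) c ∈ A.hodgePQ (2 * m) m m → Literature.Geometry.Kaehler.lefschetzOperator Λ.hyperplaneClass (Literature.AlgebraicGeometry.HodgeTheory.two_add_two_mul m) c = 0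 → c ∈ Literature.AlgebraicGeometry.HodgeTheory.algebraicClasses X m) :
    _root_.HodgeConjecture :=
  fun n _ hX => ⟨nonempty_hodgeModel_holds hX,
    fun p c hc hpp => mem_algebraicClasses_of_hodgePrimitiveMiddle hP n hX p c hc hpp⟩

/-- **The Hodge conjecture implies the primitive middle stub** (specialisation to `n := 2m`, `p := m`;
the primitivity hypothesis is not used). [cite: Deligne2000, §1] -/
theorem hodgePrimitiveMiddle_of_hodgeConjecture (hHC : _root_.HodgeConjecture) :
    ∀ (m : ℕ) (X : Literature.AlgebraicGeometry.Motives.SchemeOver ℂ), Literature.AlgebraicGeometry.Motives.IsSmoothProjective (2 * m) X → 2 ≤ m → ∀ (Λ : Literature.AlgebraicGeometry.HodgeTheory.HardLefschetzNFold (2 * m) X) (A : Literature.AlgebraicGeometry.HodgeTheory.HodgeModel (2 * m) X) (c : Literature.AlgebraicGeometry.HodgeTheory.complexBetti X (2 * m)), Literature.AlgebraicGeometry.HodgeTheory.IsRationalClass c → A.pullback (2 * m) c ∈ A.hodgePQ (2 * m) m m → Literature.Geometry.Kaehler.lefschetzOperator Λ.hyperplaneClass (Literature.AlgebraicGeometry.HodgeTheory.two_add_two_mul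 m) c = 0 → c ∈ Literature.AlgebraicGeometry.HodgeTheory.algebraicClasses X m :=
  fun m _ hX _ _ A c hc hA _ => (hHC hX).2 m c hc ⟨A, hA⟩

/-- **Certificate of the second reshape: the primitive middle stub of line `registered` is EQUIVALENT
to the summit statement** `_root_.HodgeConjecture`. [cite: KerrPearlstein2011, §3.1] [cite: Deligne2000, §1] -/
theorem hodgeConjecture_iff_hodgePrimitiveMiddle :
    _root_.HodgeConjecture ↔
      ∀ (m : ℕ) (X : Literature.AlgebraicGeometry.Motives.SchemeOver ℂ), Literature.AlgebraicGeometry.Motives.IsSmoothProjective (2 * m) X → 2 ≤ m → ∀ (Λ : Literature.AlgebraicGeometry.HodgeTheory.HardLefschetzNFold (2 * m) X) (A : Literature.AlgebraicGeometry.HodgeTheory.HodgeModel (2 * m) X) (c : Literature.AlgebraicGeometry.HodgeTheory.complexBetti X (2 * m)), Literature.AlgebraicGeometry.HodgeTheory.IsRationalClass c → A.pullback (2 * m) c ∈ A.hodgePQ (2 * m) m m → Literature.Geometry.Kaehler.lefschetzOperator Λ.hyperplaneClass (Literature.AlgebraicGeometry.HodgeTheory.two_add_two_mul m) c = 0 →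 c ∈ Literature.AlgebraicGeometry.HodgeTheory.algebraicClasses X m :=
  ⟨hodgePrimitiveMiddle_of_hodgeConjecture, hodgeConjecture_of_hodgePrimitiveMiddle⟩

/-- **The middle stub of the first reshape from the primitive middle stub** (through
`hodgeConjecture_of_hodgePrimitiveMiddle`, then specialisation). [cite: KerrPearlstein2011, §3.1] -/
theorem hodgeMiddle_of_hodgePrimitiveMiddle
    (hP : ∀ (m : ℕ) (X : Literature.AlgebraicGeometry.Motives.SchemeOver ℂ), Literature.AlgebraicGeometry.Motives.IsSmoothProjective (2 * m) X → 2 ≤ m → ∀ (Λ : Literature.AlgebraicGeometry.HodgeTheory.HardLefschetzNFold (2 * m) X) (A : Literature.AlgebraicGeometry.HodgeTheory.HodgeModel (2 * m) X) (c : Literature.AlgebraicGeometry.HodgeTheory.complexBetti X (2 * m)), Literature.AlgebraicGeometry.HodgeTheory.IsRationalClass c → A.pullback (2 * m) c ∈ A.hodgePQ (2 * m) m m → Literature.Geometry.Kaehler.lefschetzOperator Λ.hyperplaneClass (Literature.AlgebraicGeometry.HodgeTheory.two_add_two_mul m) c = 0 → c ∈ Literature.AlgebraicGeometry.HodgeTheory.algebraicClasses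 X m) :
    ∀ (m : ℕ) (X : Literature.AlgebraicGeometry.Motives.SchemeOver ℂ), Literature.AlgebraicGeometry.Motives.IsSmoothProjective (2 * m) X → 2 ≤ m → ∀ (A : Literature.AlgebraicGeometry.HodgeTheory.HodgeModel (2 * m) X) (c : Literature.AlgebraicGeometry.HodgeTheory.complexBetti X (2 * m)), Literature.AlgebraicGeometry.HodgeTheory.IsRationalClass c → A.pullback (2 * m) c ∈ A.hodgePQ (2 * m) m m → c ∈ Literature.AlgebraicGeometry.HodgeTheory.algebraicClasses X m :=
  fun m _ hX _ A c hc hA => (hodgeConjecture_of_hodgePrimitiveMiddle hP hX).2 m c hc ⟨A, hA⟩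

/-- **The crux `RateGap` from the primitive middle stub** (`hodgeConjecture_of_hodgePrimitiveMiddle`,
then the landed `rateGap_of_hodgeConjecture`: cancellation on the ray over a holomorphic cycle
support) — the skeleton theorem `RateGap_of` of line `registered` after the second c3 reshape, with
its one stub as a hypothesis (registered sub-goal). [cite: KerrPearlstein2011, §3.1] [cite: Deligne2000, §1] -/
theorem rateGap_of_hodgePrimitiveMiddle : (∀ (m : ℕ) (X : Literature.AlgebraicGeometry.Motives.SchemeOver ℂ), Literature.AlgebraicGeometry.Motives.IsSmoothProjective (2 * m) X → 2 ≤ m → ∀ (Λ : Literature.AlgebraicGeometry.HodgeTheory.HardLefschetzNFold (2 * m) X) (A : Literature.AlgebraicGeometry.HodgeTheory.HodgeModel (2 * m) X) (c : Literature.AlgebraicGeometry.HodgeTheory.complexBetti X (2 * m)), Literature.AlgebraicGeometry.HodgeTheory.IsRationalClass c → A.pullback (2 * m) c ∈ A.hodgePQ (2 * m) m m → Literature.Geometry.Kaehler.lefschetzOperator Λ.hyperplaneClass (Literature.AlgebraicGeometry.HodgeTheory.two_add_two_mul m) c = 0 → c ∈ Literature.AlgebraicGeometry.HodgeTheory.algebraicClasses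 X m) → Summit.HodgeConjecture.HodgeConjecture.Theses.HolomorphicityRate.RateGap :=
  fun hP => rateGap_of_hodgeConjecture (hodgeConjecture_of_hodgePrimitiveMiddle hP)

end Summit.HodgeConjecture.HodgeConjecture.Theorems

end
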